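import Summits.AnomalousDissipation.AnomalousDissipation.Theorems.MirrorVarietyTaylorGreenLoudGalerkinStatesLine
import Literature.Analysis.FunctionSpaces.TorusTrilinearH1
import Literature.Analysis.FunctionSpaces.TorusWeightedGalerkinCoefficients
import Literature.Analysis.FluidPDE.SteadyNSTestedFormAlgebra
import Literature.Analysis.FluidPDE.SteadyGalerkinApprox
import Literature.Analysis.Calculus.NewtonKantorovichInfSup

/-!
# Stub `stub_discreteKantorovich` of the line `stagnation-plug-froth`
# (crux stmt-AnomalousDissipation-2987, `MirrorVariety.TaylorGreenLoudGalerkinStates`)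

**Finite-dimensional Newton–Kantorovich in the `K`-symmetric Galerkin space `X_N^K` from DISCRETE data**
(the registered signature, verbatim): a band-limited `K`-field `vN` with energy `≤ E`, loudness
`ε ≤ ν‖∇vN‖²`, `K`-Galerkin residual `≤ η`, discrete inf-sup constant `M` and smallness `M²η ≤ c`,
`(Mη)² ≤ cE` (universal `c`) has a `K`-tested Galerkin steady state `U ∈ X_N^K` with
`‖∇(U − vN)‖ ≤ 2|M| max(η,0)`, energy `≤ 2E`, and loudness `≥ ε/2` if also `ν(Mη)² ≤ cε`.
* §2 realises `X_N^K` as the real submodule `galSpace N` of the EUCLIDEAN coefficient space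
  `PiLp 2 (↥S → ℂ³)`, `S = (freqBall N).erase 0` (reality, transversality, `K`-symmetry of the realised
  field `galField N c = realTrigPoly S (k ↦ galWeight k • c k)`, enstrophy weight `galWeight k = 1/(2π|k|)`);
  by Parseval `‖c‖ = √gradNormSq (galField N c)` EXACTLY (no resolution-dependent constant), and every
  band-limited `K`-field is realised (`Torus.realTrigPoly_smul_coeffExt_unweight_eq`).
* §3 applies the dual-free finite-dimensional Newton–Kantorovich theorem from inf-sup data
  `Literature.Analysis.Calculus.exists_zero_of_infSup_newton` (simplified Newton + Banach; `DF(vN)` injective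
  by inf-sup, bijective by `dim X* = dim X`) to `Φ x a = testedForm ν f (galField x) (galField a)`,
  `Λ w a = linForm ν vN (galField w) (galField a)`; the centred Lipschitz constant is Temam's trilinear
  constant `C` (`Torus.abs_integral_inner_convect_le_of_hasZeroMean`, `ν`- and `N`-free) via the exact
  Taylor remainder `Literature.Analysis.FluidPDE.integral_tested_sub_sub_linearised`; `c = min (1/1000) (1/(8C+8))`.
* §4 margins: Poincaré–Wirtinger + Minkowski (`Torus.integral_norm_sq_le_two_mul_of_gradNormSq_sub_le`) and
  the triangle inequality of `galSpace N`.  Degenerate data (`η < 0`, `M = 0` ⇒ `X_N^K = {0}`; `M < 0`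
  acts as `|M|`) come out of the proof.

Sources: Brezzi–Rappaz–Raviart, Numer. Math. 36 (1980) 1–25, Thm. 3; Girault–Raviart (1986) Ch. IV §3;
Temam (1979) Ch. II §1; Magnus (2022) Prop. 6.7.
-/

-- `Summit.<Summit>.<Problem>` is the tree's mandated summit-side namespace (CONVENTIONS §2); for this
-- single-conjunct summit the two coincide, so the duplicate is deliberate.
set_option linter.dupNamespace false

noncomputable section

open scoped BigOperators Topology InnerProductSpace
open Filter MeasureTheory
open Literature.Analysis.FunctionSpaces Literature.Analysis.FunctionSpaces.Torus

namespace Summit.AnomalousDissipation.AnomalousDissipation.Theorems.TaylorGreenLoudGalerkinStates.DiscreteKantorovich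

open Summit.AnomalousDissipation.AnomalousDissipation.Theorems.TaylorGreenLoudGalerkinStates
open Summit.AnomalousDissipation.AnomalousDissipation.Theorems.TaylorGreenLoudGalerkinStates.Negative
open Literature.Analysis.FluidPDE Literature.Analysis.Calculus

/-- The punctured frequency ball `S_N = {0 < |k|² ≤ N²}` (local macro). -/
local notation "𝕊[" N "]" => Finset.erase (freqBall N) (0 : Fin 3 → ℤ)

/-- The Euclidean coefficient space on `S_N` (local macro). -/
local notation "𝕍[" N "]" =>
  PiLp 2 (fun _ : ↥(Finset.erase (freqBall N) (0 : Fin 3 → ℤ)) => EuclideanSpace ℂ (Fin 3))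

/-! ## §1 `K`-symmetry is a real-linear condition -/

/-- `actVec M` is additive. [folklore] -/
theorem actVec_add (M : Matrix (Fin 3) (Fin 3) ℤ) (v w : EuclideanSpace ℝ (Fin 3)) :
    actVec M (v + w) = actVec M v + actVec M w := by
  simp only [actVec, WithLp.ofLp_add, Matrix.mulVec_add, WithLp.toLp_add]

/-- `actVec M` commutes with real scalars. [folklore] -/
theorem actVec_smul (M : Matrix (Fin 3) (Fin 3) ℤ) (r : ℝ) (v : EuclideanSpace ℝ (Fin 3)) :
    actVec M (r • v) = r • actVec M v := by
  simp only [actVec, WithLp.ofLp_smul, Matrix.mulVec_smul, WithLp.toLp_smul]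

/-- Sums of `K`-symmetric fields are `K`-symmetric. [folklore] -/
theorem isKSymm_add {u v : UnitAddTorus (Fin 3) → EuclideanSpace ℝ (Fin 3)} (hu : IsKSymm u)
    (hv : IsKSymm v) : IsKSymm (u + v) := fun i x => by
  simp only [Pi.add_apply, hu i x, hv i x, actVec_add]

/-- Real multiples of `K`-symmetric fields are `K`-symmetric. [folklore] -/
theorem isKSymm_smul {u : UnitAddTorus (Fin 3) → EuclideanSpace ℝ (Fin 3)} (r : ℝ) (hu : IsKSymm u) :
    IsKSymm (r • u) := fun i x => by
  simp only [Pi.smul_apply, hu i x, actVec_smul]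

/-- The zero field is `K`-symmetric. [folklore] -/
theorem isKSymm_zero : IsKSymm (0 : UnitAddTorus (Fin 3) → EuclideanSpace ℝ (Fin 3)) := fun i x => by
  simp [actVec]

/-! ## §2 The weighted coefficient realisation of `X_N^K` -/

/-- The enstrophy weight `galWeight k = 1/(2π|k|)` (value `0` at `k = 0`, never used): with it the
Euclidean norm of a coefficient vector equals the enstrophy norm of the realised field. [folklore] -/
def galWeight (k : Fin 3 → ℤ) : ℝ := (2 * Real.pi * Real.sqrt (freqNormSq k))⁻¹

/-- The weight is even. [folklore] -/
theorem galWeight_neg (k : Fin 3 → ℤ) : galWeight (-k) = galWeight k := enstrophyWeight_neg k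

/-- The realised field of a coefficient vector `c` on `S_N`:
`galField N c = Re ∑_{k ∈ S_N} e_k ⊗ (galWeight k • c k)`. [folklore] -/
def galField (N : ℕ) (c : 𝕍[N]) : UnitAddTorus (Fin 3) → EuclideanSpace ℝ (Fin 3) :=
  realTrigPoly 𝕊[N] fun k => galWeight k • coeffExt 𝕊[N] (WithLp.ofLp c) k

section Realisation

variable (N : ℕ)

/-- `galField N` is additive. [folklore] -/
theorem galField_add (c c' : 𝕍[N]) : galField N (c + c') = galField N c + galField N c' := by
  unfold galField; rw [WithLp.ofLp_add, smul_coeffExt_add, realTrigPoly_add]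

/-- `galField N` commutes with real scalars. [folklore] -/
theorem galField_smul (r : ℝ) (c : 𝕍[N]) : galField N (r • c) = r • galField N c := by
  unfold galField; rw [WithLp.ofLp_smul, smul_coeffExt_smul, realTrigPoly_smul]

/-- `galField N 0 = 0`. [folklore] -/
theorem galField_zero : galField N 0 = 0 := by
  have h := galField_smul N 0 0
  rwa [zero_smul, zero_smul] at h

/-- `galField N` respects differences. [folklore] -/
theorem galField_sub (c c' : 𝕍[N]) : galField N (c - c') = galField N c - galField N c' := by
  rw [sub_eq_add_neg, ← neg_one_smul ℝ c', galField_add, galField_smul, neg_one_smul, ← sub_eq_add_neg]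

/-- **The `K`-symmetric Galerkin space `X_N^K` in weighted coefficient coordinates**: real,
transversal coefficient vectors whose realised field is `K`-symmetric (a real subspace of the
Euclidean coefficient space; its norm is the enstrophy norm, `norm_eq_sqrt_gradNormSq`). [folklore] -/
def galSpace : Submodule ℝ 𝕍[N] where
  carrier := {c | IsRealCoeff (WithLp.ofLp c) ∧ IsSolenoidalCoeff (WithLp.ofLp c) ∧ IsKSymm (galField N c)}
  add_mem' := by
    rintro c c' ⟨h1, h2, h3⟩ ⟨h1', h2', h3'⟩
    refine ⟨?_, ?_, ?_⟩
    · rw [WithLp.ofLp_add]; exact h1.add h1'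
    · rw [WithLp.ofLp_add]; exact h2.add h2'
    · rw [galField_add]; exact isKSymm_add h3 h3'
  zero_mem' := ⟨by rw [WithLp.ofLp_zero]; exact isRealCoeff_zero,
    by rw [WithLp.ofLp_zero]; exact isSolenoidalCoeff_zero, by rw [galField_zero]; exact isKSymm_zero⟩
  smul_mem' := by
    rintro r c ⟨h1, h2, h3⟩
    refine ⟨?_, ?_, ?_⟩
    · rw [WithLp.ofLp_smul]; exact h1.smul r
    · rw [WithLp.ofLp_smul]; exact h2.smul r
    · rw [galField_smul]; exact isKSymm_smul r h3

variable {N}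

/-- Members of `X_N^K` realise `K`-fields. [folklore] -/
theorem isKField_galField {c : 𝕍[N]} (hc : c ∈ galSpace N) : IsKField (galField N c) :=
  ⟨isSmooth_realTrigPoly _ _, isDivFree_realTrigPoly (isTransversal_smul_coeffExt hc.2.1),
    hasZeroMean_realTrigPoly_of_zero_not_mem (by simp) _, hc.2.2⟩

/-- Members of `X_N^K` realise band-limited fields. [folklore] -/
theorem isBandLimited_galField {c : 𝕍[N]} (hc : c ∈ galSpace N) : IsBandLimited N (galField N c) :=
  fun _ hk => mFourierCoeff_realTrigPoly_smul_coeffExt_eq_zero neg_mem_freqBall_erase_zero galWeight_neg hc.1 hk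

/-- **The Euclidean norm on `X_N^K` is the enstrophy norm** (Parseval). [folklore] -/
theorem norm_eq_sqrt_gradNormSq {c : 𝕍[N]} (hc : c ∈ galSpace N) :
    ‖c‖ = Real.sqrt (gradNormSq (galField N c)) := by
  have h : ‖c‖ ^ 2 = gradNormSq (galField N c) := by
    rw [PiLp.norm_sq_eq_of_L2]
    unfold galField
    rw [gradNormSq_realTrigPoly_smul_coeffExt neg_mem_freqBall_erase_zero galWeight_neg
      (fun k hk => enstrophyWeight_normalised (Finset.ne_of_mem_erase hk)) hc.1]
  rw [← h, Real.sqrt_sq (norm_nonneg _)]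

/-- **Every band-limited `K`-field is realised by a member of `X_N^K`** (un-weight its Fourier
coefficients). [folklore] -/
theorem exists_mem_galSpace_galField_eq {w : UnitAddTorus (Fin 3) → EuclideanSpace ℝ (Fin 3)}
    (hw : IsKField w) (hb : IsBandLimited N w) : ∃ c ∈ galSpace N, galField N c = w := by
  set c : 𝕍[N] := WithLp.toLp 2 fun k : ↥𝕊[N] =>
    (galWeight (k : Fin 3 → ℤ))⁻¹ • UnitAddTorus.mFourierCoeff (EuclideanSpace.complexify ∘ w) k with hcdef
  have hofLp : WithLp.ofLp c = fun k : ↥𝕊[N] =>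
      (galWeight (k : Fin 3 → ℤ))⁻¹ • UnitAddTorus.mFourierCoeff (EuclideanSpace.complexify ∘ w) k := rfl
  have hfield : galField N c = w := by
    unfold galField
    rw [hofLp]
    exact realTrigPoly_smul_coeffExt_unweight_eq hw.1.continuous hb
      fun k hk => enstrophyWeight_ne_zero (Finset.ne_of_mem_erase hk)
  refine ⟨c, ⟨?_, ?_, ?_⟩, hfield⟩
  · rw [hofLp]; exact isRealCoeff_unweight galWeight_neg hw.1.integrable
  · rw [hofLp]; exact isSolenoidalCoeff_unweight hw.1 hw.2.1
  · rw [hfield]; exact hw.2.2.2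

/-- Fields band-limited to the punctured ball are mean-zero (the mean mode is excluded). [folklore] -/
theorem hasZeroMean_of_isBandLimited {a : UnitAddTorus (Fin 3) → EuclideanSpace ℝ (Fin 3)}
    (hb : IsBandLimited N a) : HasZeroMean a :=
  hasZeroMean_of_mFourierCoeff_zero (hb 0 (by simp))

end Realisation

/-! ## §3–§4 Newton–Kantorovich in `X_N^K` and the margins -/

/-- **stub_discreteKantorovich** (registered signature, verbatim): finite-dimensional
Newton–Kantorovich in the `K`-symmetric Galerkin space `X_N^K` of band-limited `K`-fields normed by
`‖∇·‖`, from DISCRETE residual / inf-sup data at resolution `N`, with a universal smallness constant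
`c` and the energy/loudness margins; see the module docstring for the construction
(`galSpace`, `exists_zero_of_infSup_newton`, Temam's trilinear constant). [cite: Temam1979, Ch. II §1 (1.25)] -/
theorem stub_discreteKantorovich : ∃ c : ℝ, 0 < c ∧ ∀ (ν E ε η M : ℝ) (N : ℕ) (f vN : UnitAddTorus (Fin 3) → EuclideanSpace ℝ (Fin 3)), 0 < ν → IsSmooth f → IsKField vN → IsBandLimited N vN → ∫ x, ‖vN x‖ ^ 2 ≤ E → ε ≤ ν * gradNormSq vN → (∀ a, IsKField a → IsBandLimited N a → |testedForm ν f vN a| ≤ η * Real.sqrt (gradNormSq a)) → (∀ w, IsKField w → IsBandLimited N w → ∃ a, IsKField a ∧ IsBandLimited N a ∧ Real.sqrt (gradNormSq w) * Real.sqrt (gradNormSq a) ≤ M * linForm ν vN w a ∧ (0 < gradNormSq w → 0 < gradNormSq a)) → M ^ 2 * η ≤ c → (M * η) ^ 2 ≤ c * E → ∃ U : UnitAddTorus (Fin 3) → EuclideanSpace ℝ (Fin 3), IsKField U ∧ IsBandLimited N U ∧ (∀ a, IsSmooth a → IsDivFree a → IsKSymm a → IsBandLimited N a → testedForm ν f U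 a = 0) ∧ ∫ x, ‖U x‖ ^ 2 ≤ 2 * E ∧ (ν * (M * η) ^ 2 ≤ c * ε → ε / 2 ≤ ν * gradNormSq U) := by
  obtain ⟨C, hC0, hC⟩ :=
    abs_integral_inner_convect_le_of_hasZeroMean (d := Fin 3) (by simp)
  have hc0 : (0 : ℝ) < min (1 / 1000) (1 / (8 * C + 8)) := lt_min (by norm_num) (by positivity)
  refine ⟨min (1 / 1000) (1 / (8 * C + 8)), hc0, ?_⟩
  intro ν E ε η M N f vN hν hf hvN hband hE hε hres hinf hs₁ hs₂
  set c₀ : ℝ := min (1 / 1000) (1 / (8 * C + 8)) with hc₀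
  have hc1 : c₀ ≤ 1 / 1000 := min_le_left _ _
  have hc2 : c₀ ≤ 1 / (8 * C + 8) := min_le_right _ _
  have hE0 : 0 ≤ E := (integral_nonneg fun x => sq_nonneg _).trans hE
  -- ### the starting point `vN ∈ X_N^K` and the nonnegative residual level
  obtain ⟨v₀, hv₀, hv₀eq⟩ := exists_mem_galSpace_galField_eq hvN hband
  set v : ↥(galSpace N) := ⟨v₀, hv₀⟩ with hvdef
  have hvcoe : (v : 𝕍[N]) = v₀ := rfl
  set η' : ℝ := max η 0 with hη'
  have hη'0 : 0 ≤ η' := le_max_right _ _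
  have hηη' : η ≤ η' := le_max_left _ _
  have hM2η' : M ^ 2 * η' ≤ c₀ := by
    rcases le_or_gt 0 η with h | h
    · rw [hη', max_eq_left h]; exact hs₁
    · rw [hη', max_eq_right h.le, mul_zero]; exact hc0.le
  have hMη'2 : (M * η') ^ 2 ≤ c₀ * E := by
    rcases le_or_gt 0 η with h | h
    · rw [hη', max_eq_left h]; exact hs₂
    · rw [hη', max_eq_right h.le, mul_zero, zero_pow two_ne_zero]; positivity
  -- ### smoothness bookkeeping
  have hsm : ∀ z : ↥(galSpace N), IsSmooth (galField N (z : 𝕍[N])) := fun z => (isKField_galField z.2).1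
  have hnorm : ∀ z : ↥(galSpace N), ‖z‖ = Real.sqrt (gradNormSq (galField N (z : 𝕍[N]))) := fun z => by
    rw [Submodule.coe_norm]; exact norm_eq_sqrt_gradNormSq z.2
  -- ### the Newton data on `T = ↥(galSpace N)`
  have hΦ : ∀ x : ↥(galSpace N), IsLinearMap ℝ fun a : ↥(galSpace N) =>
      testedForm ν f (galField N (x : 𝕍[N])) (galField N (a : 𝕍[N])) := fun x =>
    { map_add := fun a b => by
        simp only [Submodule.coe_add, galField_add]
        exact integral_tested_add_test hf.continuous (hsm x) (hsm a) (hsm b)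
      map_smul := fun r a => by
        simp only [Submodule.coe_smul, galField_smul, smul_eq_mul]
        exact integral_tested_smul_test r (hsm a) }
  have hΛw : ∀ a : ↥(galSpace N), IsLinearMap ℝ fun w : ↥(galSpace N) =>
      linForm ν vN (galField N (w : 𝕍[N])) (galField N (a : 𝕍[N])) := fun a =>
    { map_add := fun w₁ w₂ => by
        simp only [Submodule.coe_add, galField_add]
        exact integral_linearised_add_dir hvN.1 (hsm w₁) (hsm w₂) (hsm a)
      map_smul := fun r w => by
        simp only [Submodule.coe_smul, galField_smul, smul_eq_mul]
        exact integral_linearised_smul_dir r }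
  have hΛa : ∀ w : ↥(galSpace N), IsLinearMap ℝ fun a : ↥(galSpace N) =>
      linForm ν vN (galField N (w : 𝕍[N])) (galField N (a : 𝕍[N])) := fun w =>
    { map_add := fun a b => by
        simp only [Submodule.coe_add, galField_add]
        exact integral_linearised_add_test hvN.1 (hsm w) (hsm a) (hsm b)
      map_smul := fun r a => by
        simp only [Submodule.coe_smul, galField_smul, smul_eq_mul]
        exact integral_linearised_smul_test r (hsm a) }
  have hlip : ∀ x y a : ↥(galSpace N),
      |testedForm ν f (galField N (x : 𝕍[N])) (galField N (a : 𝕍[N])) -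
          testedForm ν f (galField N (y : 𝕍[N])) (galField N (a : 𝕍[N])) -
          linForm ν vN (galField N ((x - y : ↥(galSpace N)) : 𝕍[N])) (galField N (a : 𝕍[N]))| ≤
        C * (‖x - v‖ + ‖y - v‖) * ‖x - y‖ * ‖a‖ := by
    intro x y a
    have e1 : galField N ((x - y : ↥(galSpace N)) : 𝕍[N]) = galField N (x : 𝕍[N]) - galField N (y : 𝕍[N]) := by
      rw [Submodule.coe_sub, galField_sub]
    have e2 : galField N (x : 𝕍[N]) - vN = galField N ((x - v : ↥(galSpace N)) : 𝕍[N]) := by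
      rw [Submodule.coe_sub, galField_sub, hvcoe, hv₀eq]
    have e3 : galField N (y : 𝕍[N]) - vN = galField N ((y - v : ↥(galSpace N)) : 𝕍[N]) := by
      rw [Submodule.coe_sub, galField_sub, hvcoe, hv₀eq]
    have hid := integral_tested_sub_sub_linearised ν hf.continuous (hsm x) (hsm y) hvN.1 (hsm a)
    rw [e1]
    simp only [testedForm, linForm]
    rw [hid, ← e1, e2, e3]
    have hb1 := hC _ _ _ (hsm (x - y)) (hsm (x - v)) (hsm a) (isKField_galField (x - y).2).2.2.1
      (isKField_galField (x - v).2).2.2.1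
    have hb2 := hC _ _ _ (hsm (y - v)) (hsm (x - y)) (hsm a) (isKField_galField (y - v).2).2.2.1
      (isKField_galField (x - y).2).2.2.1
    rw [hnorm (x - v), hnorm (y - v), hnorm (x - y), hnorm a]
    calc _ ≤ _ := abs_add_le _ _
      _ ≤ _ := add_le_add hb1 hb2
      _ = _ := by ring
  have hres' : ∀ a : ↥(galSpace N),
      |testedForm ν f (galField N (v : 𝕍[N])) (galField N (a : 𝕍[N]))| ≤ η' * ‖a‖ := by
    intro a
    rw [hvcoe, hv₀eq, hnorm a]
    exact (hres _ (isKField_galField a.2) (isBandLimited_galField a.2)).trans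
      (mul_le_mul_of_nonneg_right hηη' (Real.sqrt_nonneg _))
  have hinf' : ∀ w : ↥(galSpace N), ∃ a : ↥(galSpace N),
      ‖w‖ * ‖a‖ ≤ M * linForm ν vN (galField N (w : 𝕍[N])) (galField N (a : 𝕍[N])) ∧
        (0 < ‖w‖ → 0 < ‖a‖) := by
    intro w
    obtain ⟨a', ha'K, ha'B, hle, hpos⟩ := hinf _ (isKField_galField w.2) (isBandLimited_galField w.2)
    obtain ⟨ca, hca, hcaeq⟩ := exists_mem_galSpace_galField_eq ha'K ha'B
    refine ⟨⟨ca, hca⟩, ?_, fun hw => ?_⟩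
    · rw [hnorm w, hnorm ⟨ca, hca⟩, Submodule.coe_mk, hcaeq]; exact hle
    · rw [hnorm ⟨ca, hca⟩, Submodule.coe_mk, hcaeq]
      rw [hnorm w] at hw
      exact Real.sqrt_pos.2 (hpos (Real.sqrt_pos.1 hw))
  have hsmall : 8 * C * M ^ 2 * η' ≤ 1 := by
    have h1 : 8 * C * M ^ 2 * η' ≤ 8 * C * c₀ := by
      have := mul_le_mul_of_nonneg_left hM2η' (by positivity : (0 : ℝ) ≤ 8 * C)
      linarith [this]
    have h2 : 8 * C * c₀ ≤ 8 * C * (1 / (8 * C + 8)) := mul_le_mul_of_nonneg_left hc2 (by positivity)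
    have h3 : 8 * C * (1 / (8 * C + 8)) ≤ 1 := by
      rw [mul_one_div, div_le_one (by positivity)]; linarith
    linarith
  -- ### Newton–Kantorovich
  obtain ⟨x, hxv, hzero⟩ := exists_zero_of_infSup_newton (T := ↥(galSpace N))
    (Φ := fun x a => testedForm ν f (galField N (x : 𝕍[N])) (galField N (a : 𝕍[N])))
    (Λ := fun w a => linForm ν vN (galField N (w : 𝕍[N])) (galField N (a : 𝕍[N])))
    hC0 hη'0 hΦ hΛw hΛa hlip hres' hinf' hsmall
  -- ### the correction `D = U - vN`, `U = galField N ↑x`, and its size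
  have hD : galField N (x : 𝕍[N]) - vN = galField N ((x - v : ↥(galSpace N)) : 𝕍[N]) := by
    rw [Submodule.coe_sub, galField_sub, hvcoe, hv₀eq]
  have hDK : IsKField (galField N (x : 𝕍[N]) - vN) := by rw [hD]; exact isKField_galField (x - v).2
  have hg4 : gradNormSq (galField N (x : 𝕍[N]) - vN) ≤ 4 * (M * η') ^ 2 := by
    have h := pow_le_pow_left₀ (norm_nonneg _) hxv 2
    rw [hnorm (x - v), ← hD, Real.sq_sqrt (gradNormSq_nonneg _)] at h
    calc gradNormSq (galField N (x : 𝕍[N]) - vN) ≤ (2 * |M| * η') ^ 2 := h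
      _ = 4 * (M * η') ^ 2 := by rw [mul_pow, mul_pow, sq_abs]; ring
  refine ⟨galField N (x : 𝕍[N]), isKField_galField x.2, isBandLimited_galField x.2, ?_, ?_, ?_⟩
  · -- ### the `K`-tested Galerkin equations
    intro a ha hda hka hba
    obtain ⟨ca, hca, hcaeq⟩ :=
      exists_mem_galSpace_galField_eq ⟨ha, hda, hasZeroMean_of_isBandLimited hba, hka⟩ hba
    have h := hzero ⟨ca, hca⟩
    rwa [Submodule.coe_mk, hcaeq] at h
  · -- ### energy margin (`TorusTrilinearH1`): `9·27·gradNormSq D ≤ 972 c₀ E ≤ E`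
    refine integral_norm_sq_le_two_mul_of_gradNormSq_sub_le hvN.1.continuous hDK.1 hDK.2.2.1 hE ?_
    rw [Fintype.card_fin]
    calc 9 * ((3 : ℕ) : ℝ) ^ 3 * gradNormSq (galField N (x : 𝕍[N]) - vN) ≤ 9 * 3 ^ 3 * (4 * (M * η') ^ 2) := by
          push_cast; gcongr
      _ ≤ 9 * 3 ^ 3 * (4 * (c₀ * E)) := by gcongr
      _ ≤ 9 * 3 ^ 3 * (4 * (1 / 1000 * E)) := by gcongr
      _ ≤ E := by linarith
  · -- ### loudness margin (under the third smallness)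
    intro hs₃
    rcases le_or_gt ε 0 with hε0 | hε0
    · have : 0 ≤ ν * gradNormSq (galField N (x : 𝕍[N])) := mul_nonneg hν.le (gradNormSq_nonneg _)
      linarith
    have hνMη' : ν * (M * η') ^ 2 ≤ c₀ * ε := by
      rcases le_or_gt 0 η with h | h
      · rw [hη', max_eq_left h]; exact hs₃
      · rw [hη', max_eq_right h.le, mul_zero, zero_pow two_ne_zero, mul_zero]; positivity
    -- triangle inequality in `X_N^K`, in enstrophy terms
    have htri : Real.sqrt (gradNormSq vN) ≤ Real.sqrt (gradNormSq (galField N (x : 𝕍[N]))) +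
        Real.sqrt (gradNormSq (galField N (x : 𝕍[N]) - vN)) := by
      have h := norm_sub_le x (x - v)
      rw [sub_sub_cancel, hnorm v, hnorm x, hnorm (x - v), hvcoe, hv₀eq, ← hD] at h
      exact h
    have hεsq : Real.sqrt ε ^ 2 = ε := Real.sq_sqrt hε0.le
    have hb2 : (Real.sqrt ν * Real.sqrt (gradNormSq (galField N (x : 𝕍[N]) - vN))) ^ 2 ≤ ε / 16 := by
      rw [mul_pow, Real.sq_sqrt hν.le, Real.sq_sqrt (gradNormSq_nonneg _)]
      calc ν * gradNormSq (galField N (x : 𝕍[N]) - vN) ≤ ν * (4 * (M * η') ^ 2) := by gcongr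
        _ = 4 * (ν * (M * η') ^ 2) := by ring
        _ ≤ 4 * (c₀ * ε) := by gcongr
        _ ≤ 4 * (1 / 1000 * ε) := by gcongr
        _ ≤ ε / 16 := by linarith
    have hb4 : Real.sqrt ν * Real.sqrt (gradNormSq (galField N (x : 𝕍[N]) - vN)) ≤ Real.sqrt ε / 4 := by
      rw [le_div_iff₀ (by norm_num : (0 : ℝ) < 4)]
      refine le_of_pow_le_pow_left₀ two_ne_zero (Real.sqrt_nonneg ε) ?_
      rw [hεsq]
      calc (Real.sqrt ν * Real.sqrt (gradNormSq (galField N (x : 𝕍[N]) - vN)) * 4) ^ 2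
          = 16 * (Real.sqrt ν * Real.sqrt (gradNormSq (galField N (x : 𝕍[N]) - vN))) ^ 2 := by ring
        _ ≤ 16 * (ε / 16) := by gcongr
        _ = ε := by ring
    have hεv : Real.sqrt ε ≤ Real.sqrt ν * Real.sqrt (gradNormSq (galField N (x : 𝕍[N]))) +
        Real.sqrt ν * Real.sqrt (gradNormSq (galField N (x : 𝕍[N]) - vN)) := by
      calc Real.sqrt ε ≤ Real.sqrt (ν * gradNormSq vN) := Real.sqrt_le_sqrt hε
        _ = Real.sqrt ν * Real.sqrt (gradNormSq vN) := Real.sqrt_mul hν.le _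
        _ ≤ Real.sqrt ν * (Real.sqrt (gradNormSq (galField N (x : 𝕍[N]))) +
              Real.sqrt (gradNormSq (galField N (x : 𝕍[N]) - vN))) :=
            mul_le_mul_of_nonneg_left htri (Real.sqrt_nonneg _)
        _ = _ := by ring
    have hs34 : 3 / 4 * Real.sqrt ε ≤ Real.sqrt ν * Real.sqrt (gradNormSq (galField N (x : 𝕍[N]))) := by
      linarith
    have hs0 : 0 ≤ 3 / 4 * Real.sqrt ε := by positivity
    calc ε / 2 ≤ (9 / 16) * ε := by linarith
      _ = (3 / 4 * Real.sqrt ε) ^ 2 := by rw [mul_pow, hεsq]; norm_num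
      _ ≤ (Real.sqrt ν * Real.sqrt (gradNormSq (galField N (x : 𝕍[N])))) ^ 2 := pow_le_pow_left₀ hs0 hs34 2
      _ = ν * gradNormSq (galField N (x : 𝕍[N])) := by
          rw [mul_pow, Real.sq_sqrt hν.le, Real.sq_sqrt (gradNormSq_nonneg _)]

end Summit.AnomalousDissipation.AnomalousDissipation.Theorems.TaylorGreenLoudGalerkinStates.DiscreteKantorovich

end
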